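import Mathlib
import HarnessLib.Audit
import Summits.PneNP.PneNP.Theorems.PstarChordRepair
import Summits.PneNP.PneNP.Theorems.PstarGraphQuadGapTwoForms

/-!
# Free constraint variables cost a constraint: every variable of `W` may be assumed read by `J` (ROUND-24, normalisation of the crux)

FRONTIER range-avoidance ladder, rung F-N3, ROUND 24 (cell `pnp-ideate`; restricted-model proof complexity — nothing here bears
on `P` versus `NP`).

The first preprocessing step of the planner's `|W| ≥ 2` analysis (memo ROUND-24-PRESEED §13 R10(v), referee care V1: "every
variable of `C₁ ∪ C₂` occurs in `J` — needs the basis change"), for ANY number of parity constraints.  Let `(J, W)` be minimal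
infeasible (`PstarGapLemma.MinInfeasible`) and let `v` be a variable of some constraint `(C₀, b₀) ∈ W` read by NO output of `J`.
Row-reduce `W` at `v`: replace every other constraint `(C, b)` containing `v` by `(C △ C₀, b ⊕ b₀)` and delete `(C₀, b₀)` (`elimW`);
the new system no longer mentions `v` and has fewer constraints, and since `v` is free for `J`, `J` is minimal infeasible for it as
well (`minInfeasible_elimW`: satisfying the reduced system and flipping `v` if necessary satisfies `W`).  Iterating,
`exists_read_support`: every minimal infeasible `(J, W)` has a `W'` with `|W'| ≤ |W|`, `J` minimal `W'`-infeasible, and every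
variable of `W'` read by some output of `J`; so a gap bound `|J| ≤ K·|W|` need only be proved for such pairs (`gapBound_of_read`).
-/

set_option linter.dupNamespace false

open Finset Literature.Computability.Complexity
open scoped symmDiff
open Summit.PneNP.PneNP.Theorems.PstarPDT (parity)
open Summit.PneNP.PneNP.Theorems.PstarSALevel (varSet)
open Summit.PneNP.PneNP.Theorems.PstarGapLemma (Sat Feasible MinInfeasible GapBound)
open Summit.PneNP.PneNP.Theorems.PstarGapPeeling (eval_update_of_not_mem)
open Summit.PneNP.PneNP.Theorems.PstarGapSupport (wsupp mem_wsupp sat_update_of_notMem)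
open Summit.PneNP.PneNP.Theorems.PstarChordRepair (parity_update_of_mem)
open Summit.PneNP.PneNP.Theorems.PstarFibrePolys (bit bit_xor bit_injective)
open Summit.PneNP.PneNP.Theorems.PstarGraphQuadGapOne (bit_parity)
open Summit.PneNP.PneNP.Theorems.PstarGraphQuadGapTwoForms (sum_symmDiff_zmod2)

namespace Summit.PneNP.PneNP.Theorems.PstarGapFreeVar

variable {n m : ℕ}

/-- Parity of a symmetric difference. -/
theorem parity_symmDiff (A B : Finset (Fin n)) (z : Fin n → Bool) : parity (A ∆ B) z = xor (parity A z) (parity B z) := by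
  classical
  apply bit_injective
  rw [bit_xor, bit_parity, bit_parity, bit_parity, sum_symmDiff_zmod2]

/-! ## Row reduction at a variable -/

/-- Pivoting the constraint `w` on `w₀` at `v`: add `w₀` to `w` if `w` contains `v`. -/
def pivot (v : Fin n) (w₀ w : Finset (Fin n) × Bool) : Finset (Fin n) × Bool :=
  if v ∈ w.1 then (w.1 ∆ w₀.1, xor w.2 w₀.2) else w

/-- The row-reduced system: every other constraint pivoted on `w₀` at `v`, and `w₀` deleted. -/
def elimW (W : Finset (Finset (Fin n) × Bool)) (w₀ : Finset (Fin n) × Bool) (v : Fin n) : Finset (Finset (Fin n) × Bool) :=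
  (W.erase w₀).image (pivot v w₀)

/-- The reduced system is smaller. -/
theorem card_elimW_lt {W : Finset (Finset (Fin n) × Bool)} {w₀ : Finset (Fin n) × Bool} (hw₀ : w₀ ∈ W) (v : Fin n) :
    (elimW W w₀ v).card < W.card :=
  card_image_le.trans_lt (card_erase_lt_of_mem hw₀)

/-- A pivoted constraint does not contain `v` (when `w₀` does). -/
theorem not_mem_pivot {v : Fin n} {w₀ : Finset (Fin n) × Bool} (hv : v ∈ w₀.1) (w : Finset (Fin n) × Bool) : v ∉ (pivot v w₀ w).1 := by
  unfold pivot
  split_ifs with h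
  · simp [mem_symmDiff, h, hv]
  · exact h

/-- The reduced system does not mention `v`. -/
theorem not_mem_wsupp_elimW {W : Finset (Finset (Fin n) × Bool)} {w₀ : Finset (Fin n) × Bool} {v : Fin n} (hv : v ∈ w₀.1) :
    v ∉ wsupp (elimW W w₀ v) := by
  classical
  intro h
  obtain ⟨w', hw', hvw'⟩ := mem_wsupp.1 h
  obtain ⟨w, -, rfl⟩ := mem_image.1 hw'
  exact not_mem_pivot hv w hvw'

/-- Given `w₀`, a pivoted constraint holds iff the original one does. -/
theorem parity_pivot_iff {v : Fin n} {w₀ : Finset (Fin n) × Bool} {z : Fin n → Bool} (hz₀ : parity w₀.1 z = w₀.2)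
    (w : Finset (Fin n) × Bool) : parity (pivot v w₀ w).1 z = (pivot v w₀ w).2 ↔ parity w.1 z = w.2 := by
  unfold pivot
  split_ifs
  · simp only [parity_symmDiff, hz₀]
    cases parity w.1 z <;> cases w.2 <;> cases w₀.2 <;> simp
  · exact Iff.rfl

/-- **Row reduction preserves the solution set**: `W` holds iff the reduced system and `w₀` hold. -/
theorem sat_iff_elimW {W : Finset (Finset (Fin n) × Bool)} {w₀ : Finset (Fin n) × Bool} (hw₀ : w₀ ∈ W) (v : Fin n)
    (z : Fin n → Bool) : Sat W z ↔ Sat (elimW W w₀ v) z ∧ parity w₀.1 z = w₀.2 := by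
  classical
  unfold PstarGapLemma.Sat elimW
  constructor
  · intro h
    have h0 := h w₀ hw₀
    refine ⟨fun w' hw' => ?_, h0⟩
    obtain ⟨w, hw, rfl⟩ := mem_image.1 hw'
    exact (parity_pivot_iff h0 w).2 (h w (mem_of_mem_erase hw))
  · rintro ⟨h, h0⟩ w hw
    by_cases hww : w = w₀
    · subst hww; exact h0
    · exact (parity_pivot_iff h0 w).1 (h _ (mem_image_of_mem _ (mem_erase.2 ⟨hww, hw⟩)))

/-! ## Free variables -/

/-- **Feasibility is unchanged by reducing at a free variable**: if `v ∈ C₀` is read by no output of `J`, then `J` is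
`W`-feasible iff it is feasible for the reduced system (flip `v` to fix `w₀`). -/
theorem feasible_iff_elimW (I : LocalMap 4 n m) (y : Fin m → Bool) {W : Finset (Finset (Fin n) × Bool)} {J : Finset (Fin m)}
    {w₀ : Finset (Fin n) × Bool} (hw₀ : w₀ ∈ W) {v : Fin n} (hv : v ∈ w₀.1) (hvJ : ∀ j ∈ J, v ∉ varSet I j) :
    Feasible I y W J ↔ Feasible I y (elimW W w₀ v) J := by
  classical
  constructor
  · rintro ⟨z, hzW, hzJ⟩
    exact ⟨z, ((sat_iff_elimW hw₀ v z).1 hzW).1, hzJ⟩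
  · rintro ⟨z, hzW, hzJ⟩
    by_cases h0 : parity w₀.1 z = w₀.2
    · exact ⟨z, (sat_iff_elimW hw₀ v z).2 ⟨hzW, h0⟩, hzJ⟩
    · refine ⟨Function.update z v (!z v), (sat_iff_elimW hw₀ v _).2 ⟨sat_update_of_notMem (not_mem_wsupp_elimW hv) hzW _, ?_⟩,
        fun j hj => by rw [eval_update_of_not_mem I j z (hvJ j hj)]; exact hzJ j hj⟩
      rw [parity_update_of_mem hv]
      revert h0
      cases parity w₀.1 z <;> cases w₀.2 <;> cases z v <;> simp

/-- **Minimal infeasibility survives reduction at a free variable**, with one constraint fewer. -/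
theorem minInfeasible_elimW (I : LocalMap 4 n m) (y : Fin m → Bool) {W : Finset (Finset (Fin n) × Bool)} {J : Finset (Fin m)}
    {w₀ : Finset (Fin n) × Bool} (hw₀ : w₀ ∈ W) {v : Fin n} (hv : v ∈ w₀.1) (hvJ : ∀ j ∈ J, v ∉ varSet I j)
    (hmin : MinInfeasible I y W J) : MinInfeasible I y (elimW W w₀ v) J :=
  ⟨fun h => hmin.1 ((feasible_iff_elimW I y hw₀ hv hvJ).2 h),
    fun j hj => (feasible_iff_elimW I y hw₀ hv fun j' hj' => hvJ j' (mem_of_mem_erase hj')).1 (hmin.2 j hj)⟩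

/-- **Normal form**: every minimal infeasible `(J, W)` has a system `W'` with at most as many constraints for which `J` is still
minimal infeasible and EVERY constraint variable is read by some output of `J`. -/
theorem exists_read_support (I : LocalMap 4 n m) (y : Fin m → Bool) (J : Finset (Fin m)) :
    ∀ W : Finset (Finset (Fin n) × Bool), MinInfeasible I y W J →
      ∃ W' : Finset (Finset (Fin n) × Bool), W'.card ≤ W.card ∧ MinInfeasible I y W' J ∧
        ∀ v ∈ wsupp W', ∃ j ∈ J, v ∈ varSet I j := by
  classical
  intro W
  induction hW : W.card using Nat.strong_induction_on generalizing W with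
  | _ k ih =>
    intro hmin
    by_cases hfree : ∃ v ∈ wsupp W, ∀ j ∈ J, v ∉ varSet I j
    · obtain ⟨v, hv, hvJ⟩ := hfree
      obtain ⟨w₀, hw₀, hvw₀⟩ := mem_wsupp.1 hv
      have hlt : (elimW W w₀ v).card < k := hW ▸ card_elimW_lt hw₀ v
      obtain ⟨W', hc, hmin', hread⟩ := ih _ hlt (elimW W w₀ v) rfl (minInfeasible_elimW I y hw₀ hvw₀ hvJ hmin)
      exact ⟨W', by omega, hmin', hread⟩
    · push Not at hfree
      exact ⟨W, hW.le, hmin, hfree⟩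

/-- **Reduction for gap bounds**: to bound minimal infeasible sets by `K·|W|` it suffices to treat pairs `(J, W)` in which every
constraint variable is read by `J`. -/
theorem gapBound_of_read {K r : ℕ} (I : LocalMap 4 n m) (y : Fin m → Bool)
    (h : ∀ (W : Finset (Finset (Fin n) × Bool)) (J : Finset (Fin m)), J.card ≤ r → MinInfeasible I y W J →
      (∀ v ∈ wsupp W, ∃ j ∈ J, v ∈ varSet I j) → J.card ≤ K * W.card) :
    GapBound K r I y := by
  intro W J hJ hmin
  obtain ⟨W', hc, hmin', hread⟩ := exists_read_support I y J W hmin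
  exact (h W' J hJ hmin' hread).trans (Nat.mul_le_mul_left K hc)

end Summit.PneNP.PneNP.Theorems.PstarGapFreeVar
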